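import Literature.Computability.MetaComplexity.ParamUniformWitness
import Literature.Computability.MetaComplexity.OneSidedHeuristics
import Literature.Computability.Complexity.AveragingCounting
import Literature.Computability.Complexity.UniformProbBlocks
import HarnessLib

/-!
# Complexity meta: Hirahara 2021, Lemma 3.6 — one-sided heuristics for parameterized uniform distributions, generator-free

Topic `Literature/Computability/MetaComplexity`, third file (theorems only) of the inline proof of
Lemma 3.6 of S. Hirahara, *Average-case hardness of NP from exponential worst-case hardness
assumptions*, ECCC TR21-058 (2021), p. 21, in the form consumed by the proof plan of
`Hirahara2021_languageCompression` (Thm. 4.2, pp. 27–29: Lemma 3.6 is invoked for the distributions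
`(w, 1^{⟨n,t⟩})` of the proof of Thm. 4.2 and `(r, 1^{⟨t,k⟩})` of the proof of Lemma 4.5):

* `ParamUniform.exists_heuristic_paramUniform` — *if `coNP × {U, T} ⊆ Avg¹_{1-n^{-c}} P` for some `c`
  and `PromiseBPP' ⊆ PromiseP`, then for every `NP` language `L'` of pairs `(r, 1^m)` there are
  `D₀ ∈ P` and a polynomial `q ≥ 1` with (1) `(r, 1^m) ∈ L' ⟹ (r, 1^m) ∈ D₀` for all `r, m` and
  (2) `Pr_{r ← {0,1}^ℓ}[(r, 1^m) ∈ D₀ ↔ (r, 1^m) ∈ L'] ≥ 1/q(ℓ + m)` for all `ℓ, m`* — for any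
  polynomial-time sample length `ℓ = ℓ(m)` the complement of `D₀` is a one-sided-error heuristic for
  `(coL', {(U_{ℓ(m)}, 1^m)}_m)` with polynomial success, which is the printed conclusion
  "`(L, D) ∈ Avg¹_{1-n^{-c'}} P`" for `L = coL' ∈ coNP` and the parameterized uniform distribution `D`
  (Def. 3.5), uniformly in the sample length;
* `ParamUniform.uniformProb_correct_ge` — the case analysis of the printed proof for one `(ℓ, m)`
  (averaging over the sample when the heuristic rejects often; otherwise it is correct and accepting
  on many samples), with the uniformly random pad of `ParamUniformWitness.lean` in place of the
  generator's outputs;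
* the bridge `ParamUniform.cnt_add_eq_card_pairs` between strings of length `ℓ + J` and
  (sample, pad) pairs, feeding the tree's averaging lemma `card_rows_ge_of_density`.

The hypothesis `PromiseBPP' ⊆ PromiseP` is the decision consequence of Lemma 3.4 ("`pr-BPP = pr-P`
by Lemma 3.4", p. 27); the printed proof uses the generator of Lemma 3.4 itself. No new definitions.

## References

* S. Hirahara, ECCC TR21-058 (2021), Def. 3.3, Def. 3.5 (p. 20), Lemma 3.6 and its proof (p. 21),
  proof of Lemma 4.5 (p. 27), proof of Thm. 4.2 (p. 28) [Hirahara2021].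
* A. Bogdanov, L. Trevisan, *Average-case complexity*, FnT–TCS 2 (2006), §2.1 [BogdanovTrevisan2006].
-/

noncomputable section

namespace Literature.Computability.MetaComplexity

open _root_.Computability Polynomial Complexity Complexity.Classes Complexity.Nondeterministic Finset

namespace ParamUniform

open scoped Classical

/-! ### Strings of length `ℓ + J` as (prefix, suffix) pairs -/

/-- **Bridge to the product space**: the strings of length `ℓ + J` in `E` are in bijection with the
pairs `(r, j) ∈ {0,1}^ℓ × {0,1}^J` with `r ++ j ∈ E`. [folklore] -/
theorem cnt_add_eq_card_pairs (ℓ J : ℕ) (E : Set (List Bool)) :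
    cnt (ℓ + J) E =
      (univ.filter fun p : List.Vector Bool ℓ × List.Vector Bool J => p.1.toList ++ p.2.toList ∈ E).card := by
  unfold cnt
  refine Finset.card_bij'
    (fun u _ => (⟨u.toList.take ℓ, by simp [u.toList_length]⟩, ⟨u.toList.drop ℓ, by simp [u.toList_length]⟩))
    (fun p _ => ⟨p.1.toList ++ p.2.toList, by simp [p.1.toList_length, p.2.toList_length]⟩)
    (fun u hu => ?_) (fun p hp => ?_) (fun u _ => ?_) (fun p _ => ?_)
  · simp only [mem_filter, mem_univ, true_and] at hu ⊢
    change u.toList.take ℓ ++ u.toList.drop ℓ ∈ E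
    rwa [List.take_append_drop]
  · simp only [mem_filter, mem_univ, true_and] at hp ⊢
    exact hp
  · exact List.Vector.toList_injective (by simp)
  · obtain ⟨a, b⟩ := p
    have ha : a.toList.length = ℓ := a.toList_length
    refine Prod.ext (List.Vector.toList_injective ?_) (List.Vector.toList_injective ?_)
    · simp [List.take_left' ha]
    · simp [List.drop_left' ha]

/-- `cnt J {j | r ++ j ∈ E}` as a count over `{0,1}^J`. [folklore] -/
theorem cnt_eq_card_filter (J : ℕ) (S : Set (List Bool)) :
    cnt J S = (univ.filter fun j : List.Vector Bool J => j.toList ∈ S).card := by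
  unfold cnt
  exact Finset.card_bij' (fun u _ => u) (fun u _ => u) (fun u hu => by simpa using hu) (fun u hu => by simpa using hu)
    (fun _ _ => rfl) (fun _ _ => rfl)

/-! ### The success bound (the case analysis of the proof of Lemma 3.6) -/

section Success

variable {A : List Bool → ℕ → Bool} {D₁ L' Y : Language Bool} {c ℓ m : ℕ}

/-- **The case analysis of the proof of Lemma 3.6**, for one sample length `ℓ` and parameter `m`
(write `J, N` for `J(ℓ, m), N(ℓ, m)`, `ε = N^{-c}`, and let `D₁ ∈ P` separate the aggregation problem). Hypotheses:
the test `A` is false on `r ++ j` whenever `(r, 1^m) ∈ L'` (no false negatives of the heuristic for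
the padded language, `hkey`); `D₁` contains every such `(r, 1^m)` (`hyesD`) and no `(r, 1^m)` on whose
pads `A` is true with probability `≥ ε/4` (`hnoD`); `A` agrees with the indicator of the complement of
the padded language `Y` with probability `≥ ε` (`hsucc`), where `u ∈ Y ↔ (u ↾ ℓ, 1^m) ∈ L'` at
length `N` (`hY`). Conclusion: `D₁` decides `(r, 1^m) ∈ L'` correctly for at least an `ε/4` fraction
of `r ∈ {0,1}^ℓ`. Proof as printed, with the pad in place of the generator's output: if `A` is true
on `≥ ε/2` of all `(r, j)` then, by averaging, `≥ ε/4` of the `r` are no-instances of the aggregation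
problem, on which `D₁` and `L'` are both negative; otherwise `A` is false and correct — hence
`(r, 1^m) ∈ L'`, where `D₁` is positive — on `> ε/2` of the pairs.
[cite: Hirahara2021, Lemma 3.6 (proof, the two cases)] -/
theorem uniformProb_correct_ge
    (hkey : ∀ r j : List Bool, r.length = ℓ → j.length = junkLen ℓ m →
      paramEnc (r, m) ∈ L' → A (r ++ j) (padLen ℓ m) = false)
    (hyesD : ∀ r : List Bool, r.length = ℓ → paramEnc (r, m) ∈ L' → paramEnc (r, m) ∈ D₁)
    (hnoD : ∀ r : List Bool, r.length = ℓ →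
      1 / (4 * (padLen ℓ m : ℝ) ^ c) ≤ uniformProb (junkLen ℓ m) {j | A (r ++ j) (padLen ℓ m) = true} →
        paramEnc (r, m) ∉ D₁)
    (hY : ∀ u : List Bool, u.length = padLen ℓ m → (u ∈ Y ↔ paramEnc (u.take ℓ, m) ∈ L'))
    (hsucc : 1 / (padLen ℓ m : ℝ) ^ c ≤ uniformProb (padLen ℓ m) {u | A u (padLen ℓ m) = Yᶜ.boolIndicator u}) :
    1 / (4 * (padLen ℓ m : ℝ) ^ c) ≤
      uniformProb ℓ {r | paramEnc (r, m) ∈ D₁ ↔ paramEnc (r, m) ∈ L'} := by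
  set J := junkLen ℓ m with hJ
  set N := padLen ℓ m with hN
  set ε : ℝ := 1 / (N : ℝ) ^ c with hε
  have hNJ : N = ℓ + J := (add_junkLen ℓ m).symm
  have hNpos : (0 : ℝ) < (N : ℝ) ^ c := by
    have : 1 ≤ N := one_le_padLen ℓ m
    positivity
  have hεpos : 0 < ε := by rw [hε]; positivity
  have hε4 : 1 / (4 * (N : ℝ) ^ c) = ε / 4 := by rw [hε]; field_simp
  rw [hε4]
  set Good : Set (List Bool) := {r | paramEnc (r, m) ∈ D₁ ↔ paramEnc (r, m) ∈ L'} with hGood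
  by_cases hcase : ε / 2 ≤ uniformProb N {u | A u N = true}
  · -- Case 1: averaging over `r`
    set P : List.Vector Bool ℓ → List.Vector Bool J → Prop := fun r j => A (r.toList ++ j.toList) N = true with hP
    have hpairs : ε / 2 * (Fintype.card (List.Vector Bool ℓ) * Fintype.card (List.Vector Bool J)) ≤
        ((univ.filter fun p : List.Vector Bool ℓ × List.Vector Bool J => P p.1 p.2).card : ℝ) := by
      have h := hcase
      have hb := cnt_add_eq_card_pairs ℓ J {u | A u N = true}
      rw [← hNJ] at hb
      rw [uniformProb_eq_cnt_div, hb, le_div_iff₀ (by positivity)] at h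
      have h2N : (2 : ℝ) ^ N = 2 ^ ℓ * 2 ^ J := by rw [hNJ, pow_add]
      simpa [card_vector, h2N, hP] using h
    have hrows := card_rows_ge_of_density P (ρ := ε / 2) (by positivity) hpairs
    have h4 : ε / 2 / 2 = ε / 4 := by ring
    -- every heavy row is a string on which `D₁` and `L'` are both negative
    have hGoodOf : ∀ r : List.Vector Bool ℓ, ε / 4 ≤ uniformProb J {j | A (r.toList ++ j) N = true} → r.toList ∈ Good := by
      intro r hprob
      have hrlen : r.toList.length = ℓ := r.toList_length
      have hnotD : paramEnc (r.toList, m) ∉ D₁ := hnoD r.toList hrlen (by rwa [hε4])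
      have hnotL : paramEnc (r.toList, m) ∉ L' := by
        intro hL
        have hzero : uniformProb J {j | A (r.toList ++ j) N = true} = 0 := by
          have h0 : cnt J {j | A (r.toList ++ j) N = true} = 0 := by
            by_contra hne
            obtain ⟨j, hj, hjA⟩ := (cnt_pos_iff J _).1 (Nat.pos_of_ne_zero hne)
            have hf := hkey r.toList j hrlen hj hL
            simp only [Set.mem_setOf_eq] at hjA
            rw [hf] at hjA
            exact Bool.false_ne_true hjA
          rw [uniformProb_eq_cnt_div, h0]
          simp
        rw [hzero] at hprob
        linarith
      change paramEnc (r.toList, m) ∈ D₁ ↔ paramEnc (r.toList, m) ∈ L'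
      simp [hnotD, hnotL]
    have hℓcard : (Fintype.card (List.Vector Bool ℓ) : ℝ) = 2 ^ ℓ := by simp [card_vector]
    rw [hℓcard, h4] at hrows
    have hfinal : ε / 4 * 2 ^ ℓ ≤ (cnt ℓ Good : ℝ) := by
      refine hrows.trans ?_
      rw [cnt_eq_card_filter]
      gcongr with r hr
      intro hheavy
      refine hGoodOf r ?_
      rw [uniformProb_eq_cnt_div, cnt_eq_card_filter, le_div_iff₀ (by positivity)]
      simpa [card_vector, hP] using hheavy
    rw [uniformProb_eq_cnt_div, le_div_iff₀ (by positivity)]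
    exact hfinal
  · -- Case 2: `A` is false and correct on `> ε/2` of the pairs
    push Not at hcase
    set Lset : Set (List Bool) := {r | paramEnc (r, m) ∈ L'} with hLset
    have hG : uniformProb N {u | A u N = Yᶜ.boolIndicator u} ≤
        uniformProb N {u | A u N = true} + uniformProb N {u | u.take ℓ ∈ Lset} := by
      refine le_trans (uniformProb_mono' fun u hu h => ?_) (uniformProb_union_le N _ _)
      simp only [Set.mem_setOf_eq] at h
      by_cases hA : A u N = true
      · exact Or.inl hA
      · right
        have hfalse : Yᶜ.boolIndicator u = false := by rw [← h]; simpa using hA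
        have huY : u ∈ Y := by
          by_contra hnot
          have : u ∈ Yᶜ := hnot
          rw [(Set.mem_iff_boolIndicator _ _).1 this] at hfalse
          exact Bool.noConfusion hfalse
        exact (hY u hu).1 huY
    have htake : uniformProb N {u | u.take ℓ ∈ Lset} = uniformProb ℓ Lset := by
      rw [hNJ]; exact uniformProb_setOf_take ℓ J Lset
    have hLgood : uniformProb ℓ Lset ≤ uniformProb ℓ Good :=
      uniformProb_mono' fun r hr h => by
        change paramEnc (r, m) ∈ D₁ ↔ paramEnc (r, m) ∈ L'
        exact ⟨fun _ => h, fun _ => hyesD r hr h⟩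
    rw [htake] at hG
    linarith

end Success

/-! ### Lemma 3.6, generator-free form -/

/-- **Hirahara 2021, Lemma 3.6, for `pr-BPP = pr-P` in place of the pseudorandom generator.**
*Assume `coNP × {U, T} ⊆ Avg¹_{1-n^{-c}} P` for some `c`, and `PromiseBPP' ⊆ PromiseP`. Then for every
language `L'` of pairs `(r, 1^m)` in `NP` there are `D₀ ∈ P` and a polynomial `q ≥ 1` such that
(1) `(r, 1^m) ∈ L' ⟹ (r, 1^m) ∈ D₀` for all `r, m` (no false negatives), and
(2) `Pr_{r ← {0,1}^ℓ}[(r,1^m) ∈ D₀ ↔ (r,1^m) ∈ L'] ≥ 1/q(ℓ + m)` for all `ℓ, m`* — i.e. for every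
polynomial-time `ℓ = ℓ(m)` the complement of `D₀` is a polynomial-time one-sided-error heuristic for
`(coL', D)` with polynomial success, `D_m = (r ← {0,1}^{ℓ(m)}, 1^m)` the parameterized uniform
distribution of Def. 3.5 (the printed Lemma 3.6: "for every `L ∈ coNP` and every parameterized
uniform distribution `D`, there exists a constant `c'` such that `(L, D) ∈ Avg¹_{1-n^{-c'}} P`"; here
the degree of `q` depends only on `c`, and one `D₀` serves all sample lengths at once). Proof: pad to
the injective length `N(ℓ, m)` (`ParamUniformPadding.lean`), apply the hypothesis to the complement of
the padded language under the uniform ensemble, aggregate over the pad in `pr-coRP ⊆ pr-BPP = pr-P`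
(`ParamUniformWitness.lean`), and count (`uniformProb_correct_ge`). [cite: Hirahara2021, Lemma 3.6] -/
theorem exists_heuristic_paramUniform
    (hyp : ∃ c : ℕ, distClass coNP {uniformEnsemble, tallyEnsemble} ⊆ Avg1DeltaP fun n => 1 - 1 / (n : ℝ) ^ c)
    (hD : PromiseBPP' ⊆ PromiseP) {L' : Language Bool} (hL' : L' ∈ NP) :
    ∃ D₀ ∈ Classes.P, ∃ q : Polynomial ℕ,
      (∀ (m : ℕ) (r : List Bool), paramEnc (r, m) ∈ L' → paramEnc (r, m) ∈ D₀) ∧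
      ∀ ℓ m : ℕ, 1 ≤ q.eval (ℓ + m) ∧
        1 / ((q.eval (ℓ + m) : ℕ) : ℝ) ≤ uniformProb ℓ {r | paramEnc (r, m) ∈ D₀ ↔ paramEnc (r, m) ∈ L'} := by
  obtain ⟨c, hc⟩ := hyp
  have hQ : (⟨(padLang L')ᶜ, uniformEnsemble⟩ : DistProblem) ∈ distClass coNP {uniformEnsemble, tallyEnsemble} :=
    ⟨compl_padLang_mem_coNP hL', Set.mem_insert _ _⟩
  obtain ⟨A, hA, h1, h2⟩ := hc hQ
  -- the heuristic has no false negatives on the padded language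
  have hkey : ∀ (ℓ m : ℕ) (r j : List Bool), r.length = ℓ → j.length = junkLen ℓ m →
      paramEnc (r, m) ∈ L' → A (r ++ j) (padLen ℓ m) = false := by
    intro ℓ m r j hr hj hL
    refine h1 (padLen ℓ m) (r ++ j) ((mem_support_uniformEnsemble_iff _ _).2 ?_) ?_
    · rw [List.length_append, hr, hj, add_junkLen]
    · exact fun h => h ((append_mem_padLang_iff hr hj).2 hL)
  obtain ⟨D₁, hD₁, hyesD, hnoD⟩ := aggProblem_mem_PromiseP (c := c) hD hA
  set Np : Polynomial ℕ := (X + 1) * (X + 1) + X with hNp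
  refine ⟨D₁, hD₁, 4 * Np ^ c, fun m r hL => hyesD ⟨r, m, rfl, fun j hj => hkey _ m r j rfl hj hL⟩, fun ℓ m => ?_⟩
  have hNle : padLen ℓ m ≤ Np.eval (ℓ + m) := padLen_le_poly ℓ m
  have hNp1 : 1 ≤ Np.eval (ℓ + m) := (one_le_padLen ℓ m).trans hNle
  refine ⟨?_, ?_⟩
  · simp only [eval_mul, eval_ofNat, eval_pow]
    nlinarith [Nat.one_le_pow c _ hNp1]
  · have hsucc : 1 / (padLen ℓ m : ℝ) ^ c ≤
        uniformProb (padLen ℓ m) {u | A u (padLen ℓ m) = (padLang L')ᶜ.boolIndicator u} := by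
      have h := h2 (padLen ℓ m)
      rw [prob_uniformEnsemble] at h
      linarith
    have hmain := uniformProb_correct_ge (Y := padLang L') (fun r j => hkey ℓ m r j)
      (fun r hr hL => hyesD ⟨r, m, rfl, fun j hj => hkey _ m r j rfl (hr ▸ hj) hL⟩)
      (fun r hr hprob hmem => hnoD ⟨r, m, rfl, by rw [hr]; exact hprob⟩ hmem)
      (fun u hu => mem_padLang_iff hu) hsucc
    refine le_trans ?_ hmain
    have hpos : (0 : ℝ) < 4 * (padLen ℓ m : ℝ) ^ c := by have := one_le_padLen ℓ m; positivity
    refine one_div_le_one_div_of_le hpos ?_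
    have hle : ((padLen ℓ m : ℕ) : ℝ) ≤ ((Np.eval (ℓ + m) : ℕ) : ℝ) := by exact_mod_cast hNle
    have := pow_le_pow_left₀ (by positivity) hle c
    simp only [eval_mul, eval_ofNat, eval_pow]
    push_cast
    linarith

end ParamUniform

end Literature.Computability.MetaComplexity
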